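import Literature.Probability.RandomPlanarGeometry.HexParafermion
import Summits.CriticalPhenomena.SAWScalingLimit.Theses.SAWDevelopingMap
import Summits.CriticalPhenomena.SAWScalingLimit.Theorems.SAWDevelopingMapNoFoldBoundSplit

/-!
# Strategist s4 sketch — crux `NoFoldBound` (stmt-CriticalPhenomena-8296)

Typed objects used in STRATEGY-CENSUS.md (s4) and in the crux idea `surface-fugacity-collar-peeling`:

* `weightedObservable` — the DCS parafermionic observable with an arbitrary VERTEX WEIGHT `y : HexVertex → ℝ`
  (Beaton–Bousquet-Mélou–de Gier–Duminil-Copin–Guttmann 2014, arXiv:1109.0358, eq. (F-def) with `y^{c(γ)}`,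
  here generalised from "weight on the surface row" to any vertex set / any weights);
* `arrivalSum` — the flux of walks ARRIVING at `v` through the mid-edge `{v,m}` without having visited `v`;
* `DeformedVertexRelation` — BBDDG Lemma 3 for arbitrary vertex weights: the DCS vertex relation at `v` acquires the
  defect `(1 - y v) · (arrival flux)`; at `y ≡ 1` it is DCS Lemma 1 (tree: `DuminilCopinSmirnov2012_lemma1`).
  Verified numerically to 1e-16 on a 24-vertex domain with random weights (scratch/ydeform.py).
* `LoopFirstMoment` — the first-moment strengthening of `SlitLoopFifth` (census §Strengthen S7), recorded to be
  dismissed: the loop-length law at a needle tip has tail `≍ n^{-7/4}` (lead c7), so no moment of order `≥ 3/4` is finite.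
-/

namespace Summit.CriticalPhenomena.SAWScalingLimit.Cruxes.NoFoldBound.SurfaceDeformation

open Literature.Probability.LatticeModels Literature.Probability.RandomPlanarGeometry.SAW

/-- `F_y(z) = Σ_{γ ⊂ Ω : a → z} e^{-iσ W(γ)} x^{ℓ(γ)} ∏_{w ∈ γ} y(w)` — the vertex-weighted parafermionic observable. -/
noncomputable def weightedObservable (Λ : Finset HexVertex) (a : Sym2 HexVertex) (x σ : ℝ)
    (y : HexVertex → ℝ) (z : Sym2 HexVertex) : ℂ :=
  ∑ γ : HexMidEdgeSAW Λ a z, γ.weight x σ * ((γ.verts.map y).prod : ℝ)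

/-- The weighted flux of walks arriving at `v` along the mid-edge `{v, m}` WITHOUT having visited `v`
(their last vertex is `m`, or the walk is the trivial walk at the source mid-edge `a = {u, v}`). -/
noncomputable def arrivalSum (Λ : Finset HexVertex) (a : Sym2 HexVertex) (x σ : ℝ)
    (y : HexVertex → ℝ) (v m : HexVertex) : ℂ :=
  ∑ γ : HexMidEdgeSAW Λ a s(v, m), if v ∉ γ.verts then γ.weight x σ * ((γ.verts.map y).prod : ℝ) else 0

/-- **Deformed vertex relation** (BBDDG 2014 Lemma 3, arbitrary vertex weights): at `x = x_c`, `σ = 5/8`, for every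
vertex `v` of a simply connected domain with boundary source `a` and every weight `y`,
`Σ_{m ∈ {p,q,r}} (mid{v,m} − c(v)) F_y({v,m}) = (1 − y v) · Σ_{m} (mid{v,m} − c(v)) · arrivalSum(v, m)`.
The triplet grouping of DCS gives `1 − 2 x_c y(v) cos(π/8) = 1 − y(v)` instead of `0`; pairs still cancel. -/
def DeformedVertexRelation : Prop :=
  ∀ (Λ : Finset HexVertex), hexDomainSimplyConnected Λ →
    ∀ a ∈ hexDomainBoundary Λ, ∀ (y : HexVertex → ℝ), ∀ v ∈ Λ, ∀ p q r : HexVertex,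
      hexGraph.Adj v p → hexGraph.Adj v q → hexGraph.Adj v r → p ≠ q → q ≠ r → p ≠ r →
        (hexMidpoint s(v, p) - hexCenter v) * weightedObservable Λ a hexCriticalFugacity (5 / 8) y s(v, p) +
          (hexMidpoint s(v, q) - hexCenter v) * weightedObservable Λ a hexCriticalFugacity (5 / 8) y s(v, q) +
          (hexMidpoint s(v, r) - hexCenter v) * weightedObservable Λ a hexCriticalFugacity (5 / 8) y s(v, r) =
        (1 - (y v : ℂ)) *
          ((hexMidpoint s(v, p) - hexCenter v) * arrivalSum Λ a hexCriticalFugacity (5 / 8) y v p +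
            (hexMidpoint s(v, q) - hexCenter v) * arrivalSum Λ a hexCriticalFugacity (5 / 8) y v q +
            (hexMidpoint s(v, r) - hexCenter v) * arrivalSum Λ a hexCriticalFugacity (5 / 8) y v r)

/-- **Exit form of the arrival flux at a collar vertex** (the bookkeeping behind BBDDG Prop. 4): if `v ∈ Λ` has exactly
one neighbour `n ∉ Λ` (one outer mid-edge `{v,n}`) then every arrival at `v` extends bijectively to an exit through
`{v,n}`, and `(mid{v,m} − c(v)) e^{-iσW(α)} = −(mid{v,n} − c(v)) e^{-iσW(β)} e^{∓ iπ/8}` (sign = chirality of the last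
turn), so that in the summed identity the exits through a `y`-weighted collar vertex carry the coefficient
`1 + (1 − y) e^{∓iπ/8} / (x_c y)`, equal to `± i·tan(π/8)` at `y* = 1 + √2` (verified numerically, scratch/ydeform.py).
Typed here only as the modulus statement it implies for `y = 1`: the arrival flux is `x_c⁻¹ ×` the exit mass. -/
def ArrivalExitModulus : Prop :=
  ∀ (Λ : Finset HexVertex), hexDomainSimplyConnected Λ →
    ∀ a ∈ hexDomainBoundary Λ, ∀ v ∈ Λ, ∀ n p q : HexVertex, n ∉ Λ → p ∈ Λ → q ∈ Λ →
      hexGraph.Adj v n → hexGraph.Adj v p → hexGraph.Adj v q → p ≠ q → s(v, n) ≠ a →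
        (∑ γ : HexMidEdgeSAW Λ a s(v, n), hexCriticalFugacity ^ γ.length) =
          hexCriticalFugacity *
            ((∑ γ : HexMidEdgeSAW Λ a s(v, p), if v ∉ γ.verts then hexCriticalFugacity ^ γ.length else 0) +
              ∑ γ : HexMidEdgeSAW Λ a s(v, q), if v ∉ γ.verts then hexCriticalFugacity ^ γ.length else 0)

/-- Census §Strengthen S7 (to be DISMISSED, not filed): a first-moment strengthening of `SlitLoopFifth`. False in kind:
at a needle tip the returning-loop length law has tail `≍ n^{-7/4}` (rooted polygons `≍ n^{3/4} p_n`, lead c7), so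
`Σ_γ ℓ(γ) x_c^{ℓ(γ)} = ∞` already for the straight needle; only moments of order `< 3/4` are finite. -/
def LoopFirstMoment : Prop :=
  ∃ C : ℝ, ∀ (Λ : Finset HexVertex), hexDomainSimplyConnected Λ →
    ∀ u v w₁ w₂ : HexVertex, u ∉ Λ → v ∈ Λ → hexGraph.Adj v u → hexGraph.Adj v w₁ → hexGraph.Adj v w₂ →
      u ≠ w₁ → u ≠ w₂ → w₁ ≠ w₂ →
        (∑ γ : HexMidEdgeSAW (Λ.erase v) s(v, w₁) s(v, w₂), (γ.length : ℝ) * hexCriticalFugacity ^ γ.length) ≤ C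

/-- Census §Decomposition: the route split is executable — its glue is a tree theorem (p142198): the four children of
SPLIT-PROPOSAL.md compose to the crux BY NAME (`noFoldBound_of_subs`), and the split is tight at C₄
(`noFoldDeep3_of_noFoldBound`). Both names resolve: -/
example := @Summit.CriticalPhenomena.SAWScalingLimit.Theorems.SAWDevelopingMapNoFoldBound.noFoldBound_of_subs
example := @Summit.CriticalPhenomena.SAWScalingLimit.Theorems.SAWDevelopingMapNoFoldBound.noFoldDeep3_of_noFoldBound

end Summit.CriticalPhenomena.SAWScalingLimit.Cruxes.NoFoldBound.SurfaceDeformation
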